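import Literature.Topology.FourManifolds.ModifiedFibreCoordinate
import Literature.Topology.FourManifolds.ModifiedFibreDistance
import Literature.Topology.FourManifolds.StraightenedTube
import HarnessLib

/-!
# The distance function of one family with round thin tubes

Topic `Literature/Topology/FourManifolds` (fact seat
`provefact-Literature.Topology.FourManifolds.Matvey-69322e0896`, rung (H4)
`Literature.Topology.FourManifolds.Matveyev1996_partOne_and_fact_of_dualSpheres` of
`CorkDecompositionMiddleLevel.lean`).  The regular neighbourhood
`V₀ = Nd_N(S_* ∪ P_*)` of the middle-level configuration of the cork decomposition theorem
(Matveyev 1996, arXiv:dg-ga/9505001, p. 1; Kirby 1996, arXiv:math/9712231, §3) is presented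
in the tree as a regular sublevel set assembled from one smooth "distance function" per family
(`PlumbingFamilyDistance.lean`, `PlumbedNeighbourhood.lean`).  For the *topology* of `V₀`
(Matveyev, p. 1: *"Manifold `V₀` has a free fundamental group and its second homology are
generated by classes of spheres `Sᵢ` and `Pᵢ`"*) one needs to know the thin tubes
`{H_S < t}` as spaces.  This file rebuilds the distance function of a family `S` on the
**straightened tubes** of `StraightenedTube.lean`, in which the modified fibre coordinate is
the fibre projection, so that the thin tubes are *round*: `{H_S < t}` is the disjoint union
of the tubes `φ'ᵢ(Sᵃ × B(0, √t))` of a framed family `S'` with the same core spheres, and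
`H_S(φ'ᵢ(x, w)) = ‖w‖²`.  Near each crossing `H_S = ‖σ⁻¹ ∘ Ψ_c,₂‖²` for the adapted chart
`Ψ_c` and one radial diffeomorphism `σ = univBall 0 ρ` of the fibre.  Everything is proved;
no definitions, no named facts:

* `Literature.Topology.FourManifolds.eqOn_Icc_of_lt_imp_eq` — a connectedness lemma on
  `[0, 1]` (two continuous functions that agree wherever the first is below a threshold never
  crossed by the second agree everywhere);
* `Literature.Topology.FourManifolds.FramedSphereFamily.exists_roundFamilyDistance` — the
  distance function with round tubes, as described.

## References

* R. Matveyev, *A decomposition of smooth simply-connected h-cobordant 4-manifolds*,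
  J. Differential Geom. 44 (1996) 571–582; arXiv:dg-ga/9505001, Proof of Theorem, p. 1.
  [Matveyev1996]
* R. Kirby, *Akbulut's corks and h-cobordisms of smooth, simply connected 4-manifolds*, Turkish
  J. Math. 20 (1996) 85–93; arXiv:math/9712231, §3. [KirbyCorks1996]
* J. Milnor, *Lectures on the h-cobordism theorem*, Princeton (1965), Def. 3.9 (PDF p. 16),
  PDF p. 27. [MilnorHCobordism1965]
* M. W. Hirsch, *Differential Topology*, GTM 33 (1976), Ch. 4 §5. [HirschDT1976]
-/

open scoped Manifold ContDiff Topology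
open Set Function Filter Metric

noncomputable section

namespace Literature.Topology.FourManifolds

universe u v w

/-! ### A connectedness lemma on the unit interval -/

/-- If `f, g : ℝ → ℝ` are continuous, `f 0 < τ`, `g < τ` on `[0, 1]`, and `f s = g s` at every
`s ∈ [0, 1]` with `f s < τ`, then `f = g` on `[0, 1]`: the sets `{f < τ}` and `{f ≠ g}` are
open, cover `[0, 1]`, and are disjoint on it, so by connectedness the second does not meet
`[0, 1]`. [folklore] -/
theorem eqOn_Icc_of_lt_imp_eq {f g : ℝ → ℝ} {τ : ℝ} (hf : Continuous f) (hg : Continuous g)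
    (h0 : f 0 < τ) (hg1 : ∀ s ∈ Icc (0 : ℝ) 1, g s < τ)
    (hfg : ∀ s ∈ Icc (0 : ℝ) 1, f s < τ → f s = g s) : ∀ s ∈ Icc (0 : ℝ) 1, f s = g s := by
  have hpre := isPreconnected_Icc (a := (0 : ℝ)) (b := 1)
  have hu : IsOpen {s : ℝ | f s < τ} := isOpen_lt hf continuous_const
  have hv : IsOpen {s : ℝ | f s ≠ g s} := isOpen_ne_fun hf hg
  have hcover : Icc (0 : ℝ) 1 ⊆ {s : ℝ | f s < τ} ∪ {s : ℝ | f s ≠ g s} := fun s hs => by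
    by_cases h : f s < τ
    · exact Or.inl h
    · refine Or.inr fun heq => h ?_
      rw [heq]
      exact hg1 s hs
  have hne : (Icc (0 : ℝ) 1 ∩ {s : ℝ | f s < τ}).Nonempty := ⟨0, ⟨le_rfl, zero_le_one⟩, h0⟩
  intro s hs
  by_contra hsv
  obtain ⟨r, hr, hru, hrv⟩ := hpre _ _ hu hv hcover hne ⟨s, hs, hsv⟩
  exact hrv (hfg r hr hru)

namespace FramedSphereFamily

variable {n a b : ℕ} {N : Type u} [TopologicalSpace N] [T2Space N]
  [ChartedSpace (EuclideanSpace ℝ (Fin n)) N] [IsManifold (𝓡 n) ∞ N] {ι : Type v} [Finite ι]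

/-- **The distance function of one family, with round thin tubes.**  Let `S` be a finite
framed family of `a`-spheres with `b`-dimensional fibre in the Hausdorff `n`-manifold `N`,
`a + b = n`, and let `Ψ_c : N ⇀ ℝᵃ × ℝᵇ` (`c ∈ C`, finite) be charts, smooth on their domains,
with smooth functions `χ_c`, `tsupport χ_c ⊆ (Ψ_c).source`, such that at every point `Sᵢ(x)`
of `tsupport χ_c`: `Ψ_c,₂(Sᵢ x) = 0` and `d(w ↦ Ψ_c,₂(φᵢ(x, w)))_0 = id` (adapted charts at the
crossings, bumps concentrated there — the hypotheses of `exists_familyDistance`).  Then there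
are a framed family `S'` with **the same core spheres** (`φ'ᵢ(x, 0) = φᵢ(x, 0)`) and tubes
inside the old ones (`φ'ᵢ(Sᵃ × ℝᵇ) ⊆ φᵢ(Sᵃ × ℝᵇ)`), a `C^∞` function `H_S : N → ℝ`, and
numbers `τ, ρ > 0` such that: `0 ≤ H_S`; `H_S z = 0 ↔ z` lies on a core sphere; `H_S` has no
critical point where `0 < H_S < τ`; **`H_S(φ'ᵢ(x, w)) = ‖w‖²` whenever `‖w‖² < τ`**, and for
`0 < t ≤ τ` **the thin tube `{H_S < t}` is the union of the round tubes `φ'ᵢ(Sᵃ × B(0, √t))`**;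
and near every point `z` of the cores at which `χ_c ≡ 1` and the other `χ_c'` vanish
identically nearby, `H_S = ‖σ⁻¹(Ψ_c,₂)‖²` with `σ = univBall 0 ρ` Mathlib's radial
diffeomorphism `ℝᵇ ≅ B(0, ρ)`.  Construction: the modified fibre coordinates `Fᵢ`
(`exists_modifiedFibreCoordinate`), the straightened tubes `φ'ᵢ` with `Fᵢ ∘ φ'ᵢ = σ ∘ pr₂` for
one common `ρ` (`exists_straightenedTube`), the straightened coordinates `F'ᵢ = σ⁻¹ ∘ Fᵢ`
(`F'ᵢ ∘ φ'ᵢ = pr₂`), their clamped squared fibre distances with a common plateau `τ`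
(`exists_clampedFibreDistance`), and `H_S = τ + Σᵢ (Hᵢ - τ)`; that `Hᵢ(φ'ᵢ(x, w)) = ‖w‖²` all
along `‖w‖² < τ` (not only near the core) is the connectedness lemma `eqOn_Icc_of_lt_imp_eq`
along the fibre rays.  This presents `Nd_N(S_*)` (Matveyev 1996, p. 1; Kirby 1996, §3;
Milnor 1965, PDF p. 27) with tubes one can read the homotopy type from.
[cite: Matveyev1996, Proof of Theorem (arXiv p. 1)] [cite: KirbyCorks1996, §3]
[cite: MilnorHCobordism1965, Def. 3.9 (PDF p. 16), PDF p. 27] -/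
theorem exists_roundFamilyDistance (hab : a + b = n) (S : FramedSphereFamily (𝓡 n) N ι a b)
    {C : Type w} [Fintype C]
    (Ψ : C → OpenPartialHomeomorph N (EuclideanSpace ℝ (Fin a) × EuclideanSpace ℝ (Fin b)))
    (χ : C → N → ℝ)
    (hΨ : ∀ c, ContMDiffOn (𝓡 n) 𝓘(ℝ, EuclideanSpace ℝ (Fin a) × EuclideanSpace ℝ (Fin b)) ∞
      (Ψ c) (Ψ c).source)
    (hχ : ∀ c, ContMDiff (𝓡 n) 𝓘(ℝ, ℝ) ∞ (χ c))
    (hsupp : ∀ c, tsupport (χ c) ⊆ (Ψ c).source)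
    (hplane : ∀ c i x, S.sphere i x ∈ tsupport (χ c) → (Ψ c (S.sphere i x)).2 = 0)
    (hnorm : ∀ c i x, S.sphere i x ∈ tsupport (χ c) →
      HasFDerivAt (fun w : EuclideanSpace ℝ (Fin b) => (Ψ c (S.toFun i (x, w))).2)
        (ContinuousLinearMap.id ℝ (EuclideanSpace ℝ (Fin b))) 0) :
    ∃ (S' : FramedSphereFamily (𝓡 n) N ι a b) (HS : N → ℝ) (τ ρ : ℝ), 0 < τ ∧ 0 < ρ ∧
      (∀ i x, S'.toFun i (x, 0) = S.toFun i (x, 0)) ∧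
      (∀ i, range (S'.toFun i) ⊆ range (S.toFun i)) ∧
      ContMDiff (𝓡 n) 𝓘(ℝ, ℝ) ∞ HS ∧
      (∀ z, 0 ≤ HS z) ∧
      (∀ z, HS z = 0 ↔ z ∈ S.cores) ∧
      (∀ z, 0 < HS z → HS z < τ → ¬ IsMCriticalPt (𝓡 n) HS z) ∧
      (∀ i x (w : EuclideanSpace ℝ (Fin b)), ‖w‖ ^ 2 < τ → HS (S'.toFun i (x, w)) = ‖w‖ ^ 2) ∧
      (∀ t : ℝ, 0 < t → t ≤ τ →
        {z | HS z < t} =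
          ⋃ i, S'.toFun i '' (univ ×ˢ ball (0 : EuclideanSpace ℝ (Fin b)) (Real.sqrt t))) ∧
      (∀ c, ∀ z ∈ S.cores, χ c =ᶠ[𝓝 z] (fun _ => (1 : ℝ)) →
        (∀ c', c' ≠ c → χ c' =ᶠ[𝓝 z] fun _ => (0 : ℝ)) →
        HS =ᶠ[𝓝 z] fun y =>
          ‖(OpenPartialHomeomorph.univBall (0 : EuclideanSpace ℝ (Fin b)) ρ).symm (Ψ c y).2‖ ^ 2)
              := by
  classical
  haveI := Fintype.ofFinite ι
  -- ### per sphere: the modified fibre coordinate and the straightened tube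
  have hper : ∀ i, ∃ (F : N → EuclideanSpace ℝ (Fin b)) (ε ρ₀ : ℝ), 0 < ε ∧ 0 < ρ₀ ∧
      ContMDiffOn (𝓡 n) 𝓘(ℝ, EuclideanSpace ℝ (Fin b)) ∞ F (range (S.toFun i)) ∧
      (∀ c z, χ c z = 1 → (∀ c', c' ≠ c → χ c' z = 0) → F z = (Ψ c z).2) ∧
      ∀ ρ : ℝ, 0 < ρ → ρ ≤ ρ₀ →
        ∃ φ : (Metric.sphere (0 : EuclideanSpace ℝ (Fin (a + 1))) 1) × EuclideanSpace ℝ (Fin b) → N,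
        Manifold.IsSmoothEmbedding ((𝓡 a).prod 𝓘(ℝ, EuclideanSpace ℝ (Fin b))) (𝓡 n) ∞ φ ∧
        IsOpen (range φ) ∧
        (∀ x w, ∃ v : EuclideanSpace ℝ (Fin b), ‖v‖ < ε ∧ φ (x, w) = S.toFun i (x, v)) ∧
        (∀ x, φ (x, 0) = S.toFun i (x, 0)) ∧
        (∀ x w, F (φ (x, w)) =
          OpenPartialHomeomorph.univBall (0 : EuclideanSpace ℝ (Fin b)) ρ w) ∧
        (∀ x (v : EuclideanSpace ℝ (Fin b)), ‖v‖ < ε → ‖F (S.toFun i (x, v))‖ < ρ →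
          ∃ w, φ (x, w) = S.toFun i (x, v)) := by
    intro i
    obtain ⟨F, hF, hF0, hFd, hFc, -⟩ := S.exists_modifiedFibreCoordinate i Ψ χ hΨ hχ hsupp
      (fun c x hx => hplane c i x hx) (fun c x hx => hnorm c i x hx)
    obtain ⟨ε, ρ₀, hε, hρ₀, hφ⟩ := S.exists_straightenedTube hab i hF hF0 hFd
    exact ⟨F, ε, ρ₀, hε, hρ₀, hF, hFc, hφ⟩
  choose F ε ρ₀ hε hρ₀ hF hFc hφ using hper
  -- ### the empty family
  rcases isEmpty_or_nonempty ι with hι | hι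
  · refine ⟨S, fun _ => 1, 1, 1, one_pos, one_pos, fun i => isEmptyElim i, fun i => isEmptyElim i,
      contMDiff_const, fun _ => zero_le_one, fun z => ?_, fun z _ h1 => absurd h1 (lt_irrefl _),
      fun i => isEmptyElim i, fun t _ ht1 => ?_, fun c z hz => ?_⟩
    · refine ⟨fun h => absurd h one_ne_zero, fun hz => ?_⟩
      obtain ⟨i, -, -⟩ := S.mem_cores_iff.1 hz
      exact isEmptyElim i
    · ext z
      simp only [mem_setOf_eq, mem_iUnion, not_lt.2 ht1, false_iff]
      rintro ⟨i, -⟩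
      exact isEmptyElim i
    · obtain ⟨i, -, -⟩ := S.mem_cores_iff.1 hz
      exact isEmptyElim i
  -- ### a common radius `ρ`, the straightened family `S'`
  obtain ⟨i₁, hi₁⟩ := Finite.exists_min ρ₀
  set ρ := ρ₀ i₁ with hρ_def
  have hρ : 0 < ρ := hρ₀ i₁
  have hφ' := fun i => hφ i ρ hρ (hi₁ i)
  choose φ hφemb hφopen hφfib hφzero hFφ hφcov using hφ'
  set σ := OpenPartialHomeomorph.univBall (0 : EuclideanSpace ℝ (Fin b)) ρ with hσ_def
  have hφsub : ∀ i, range (φ i) ⊆ range (S.toFun i) := by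
    rintro i _ ⟨⟨x, w⟩, rfl⟩
    obtain ⟨v, -, hv⟩ := hφfib i x w
    exact ⟨(x, v), hv.symm⟩
  let S' : FramedSphereFamily (𝓡 n) N ι a b :=
    { toFun := φ
      isSmoothEmbedding := hφemb
      isOpen_range := hφopen
      disjoint_range := fun i j hij =>
        Set.disjoint_of_subset (hφsub i) (hφsub j) (S.disjoint_range hij) }
  have hS'apply : ∀ i q, S'.toFun i q = φ i q := fun i q => rfl
  -- ### the straightened coordinates `F'ᵢ = σ⁻¹ ∘ Fᵢ`, with `F'ᵢ ∘ φ'ᵢ = pr₂`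
  set F' : ι → N → EuclideanSpace ℝ (Fin b) := fun i z => σ.symm (F i z) with hF'_def
  have hF'φ : ∀ i x w, F' i (φ i (x, w)) = w := by
    intro i x w
    have h1 : F' i (φ i (x, w)) = σ.symm (σ w) := by
      simp only [hF'_def, hFφ i x w, hσ_def]
    rw [h1]
    exact σ.left_inv (by rw [hσ_def, OpenPartialHomeomorph.univBall_source]; exact mem_univ w)
  have hF's : ∀ i, ContMDiffOn (𝓡 n) 𝓘(ℝ, EuclideanSpace ℝ (Fin b)) ∞ (F' i) (range (φ i)) := by
    intro i
    have h1 : ContMDiffOn (𝓡 n) 𝓘(ℝ, EuclideanSpace ℝ (Fin b)) ∞ (F i) (range (φ i)) :=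
      (hF i).mono (hφsub i)
    have h2 : ContMDiffOn 𝓘(ℝ, EuclideanSpace ℝ (Fin b)) 𝓘(ℝ, EuclideanSpace ℝ (Fin b)) ∞ σ.symm
        (ball (0 : EuclideanSpace ℝ (Fin b)) ρ) := by
      rw [hσ_def]
      exact OpenPartialHomeomorph.contDiffOn_univBall_symm.contMDiffOn
    refine h2.comp h1 ?_
    rintro _ ⟨⟨x, w⟩, rfl⟩
    show F i (φ i (x, w)) ∈ ball (0 : EuclideanSpace ℝ (Fin b)) ρ
    rw [hFφ i x w]
    exact univBall_mem_ball hρ w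
  have hF'0 : ∀ i x, F' i (S'.sphere i x) = 0 := fun i x => hF'φ i x 0
  have hF'd : ∀ i x, HasFDerivAt (fun w : EuclideanSpace ℝ (Fin b) => F' i (S'.toFun i (x, w)))
      (ContinuousLinearMap.id ℝ (EuclideanSpace ℝ (Fin b))) 0 := by
    intro i x
    have h : (fun w : EuclideanSpace ℝ (Fin b) => F' i (S'.toFun i (x, w))) = id :=
      funext fun w => hF'φ i x w
    rw [h]
    exact hasFDerivAt_id 0
  -- ### per sphere: the clamped squared fibre distance, with a common plateau `τ`
  have hclamp := fun i => S'.exists_clampedFibreDistance i (hF's i) (hF'0 i) (hF'd i)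
  choose τ₀ hτ₀ hH using hclamp
  obtain ⟨i₀, hi₀⟩ := Finite.exists_min τ₀
  set τ := τ₀ i₀ with hτ_def
  have hτ : 0 < τ := hτ₀ i₀
  have hH' := fun i => hH i τ hτ (hi₀ i)
  choose H hHs hH0 hHτ hHz hHloc hHreg using hH'
  -- ### the family function `H_S = τ + Σᵢ (Hᵢ - τ)`
  set HS : N → ℝ := fun z => τ + ∑ i, (H i z - τ) with hHS_def
  have hdisj : ∀ {i j : ι} {z : N}, z ∈ range (φ i) → z ∈ range (φ j) → i = j := by
    intro i j z hi hj
    by_contra hij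
    exact Set.disjoint_left.1 (S'.disjoint_range hij) hi hj
  have hval : ∀ i z, z ∈ range (φ i) → HS z = H i z := by
    intro i z hz
    have h1 : ∑ j, (H j z - τ) = H i z - τ := by
      refine Finset.sum_eq_single i (fun j _ hj => ?_) fun h => absurd (Finset.mem_univ i) h
      rw [hHτ j z fun hz' => hj (hdisj hz' hz), sub_self]
    simp only [hHS_def, h1]
    ring
  have hval' : ∀ z, (∀ i, z ∉ range (φ i)) → HS z = τ := by
    intro z hz
    have h1 : ∑ j, (H j z - τ) = 0 :=
      Finset.sum_eq_zero fun j _ => by rw [hHτ j z (hz j), sub_self]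
    simp only [hHS_def, h1, add_zero]
  have hsmooth : ContMDiff (𝓡 n) 𝓘(ℝ, ℝ) ∞ HS :=
    contMDiff_const.add (ContMDiff.sum fun i _ => (hHs i).sub contMDiff_const)
  have hlt : ∀ z, HS z < τ → ∃ i, z ∈ range (φ i) := by
    intro z hz
    by_contra h
    push Not at h
    rw [hval' z h] at hz
    exact lt_irrefl _ hz
  have hloc : ∀ i z, z ∈ range (φ i) → HS =ᶠ[𝓝 z] H i := fun i z hz => by
    filter_upwards [(hφopen i).mem_nhds hz] with y hy using hval i y hy
  have hsph : ∀ i x, φ i (x, 0) ∈ range (φ i) := fun i x => mem_range_self _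
  have hHi0 : ∀ i x, H i (φ i (x, 0)) = 0 := fun i x => (hHz i _).2 ⟨x, rfl⟩
  -- ### on a straightened tube, `Hᵢ = ‖w‖²` as long as `‖w‖² < τ` (fibre rays)
  have hround : ∀ i x (w : EuclideanSpace ℝ (Fin b)), ‖w‖ ^ 2 < τ → H i (φ i (x, w)) = ‖w‖ ^ 2 := by
    intro i x w hw
    set f : ℝ → ℝ := fun s => H i (φ i (x, s • w)) with hf_def
    set g : ℝ → ℝ := fun s => ‖s • w‖ ^ 2 with hg_def
    have hφc : Continuous (φ i) := (hφemb i).contMDiff.continuous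
    have hfc : Continuous f :=
      (hHs i).continuous.comp (hφc.comp (continuous_const.prodMk (continuous_id.smul
        continuous_const)))
    have hgc : Continuous g := ((continuous_id.smul continuous_const).norm).pow 2
    have hf0 : f 0 < τ := by
      simp only [hf_def, zero_smul, hHi0 i x]
      exact hτ
    have hg1 : ∀ s ∈ Icc (0 : ℝ) 1, g s < τ := by
      intro s hs
      have hs1 : s ^ 2 ≤ 1 := by
        have : |s| ≤ 1 := abs_le.2 ⟨by linarith [hs.1], hs.2⟩
        calc s ^ 2 = |s| ^ 2 := (sq_abs s).symm
          _ ≤ 1 ^ 2 := by gcongr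
          _ = 1 := one_pow 2
      calc g s = s ^ 2 * ‖w‖ ^ 2 := by
            simp only [hg_def, norm_smul, mul_pow, Real.norm_eq_abs, sq_abs]
        _ ≤ 1 * ‖w‖ ^ 2 := by gcongr
        _ = ‖w‖ ^ 2 := one_mul _
        _ < τ := hw
    have hfg : ∀ s ∈ Icc (0 : ℝ) 1, f s < τ → f s = g s := by
      intro s _ hs
      have h := (hHloc i _ hs).eq_of_nhds
      simp only [hF'φ] at h
      exact h
    have h1 := eqOn_Icc_of_lt_imp_eq hfc hgc hf0 hg1 hfg 1 ⟨zero_le_one, le_rfl⟩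
    simpa [hf_def, hg_def, one_smul] using h1
  have hroundS : ∀ i x (w : EuclideanSpace ℝ (Fin b)), ‖w‖ ^ 2 < τ →
      HS (φ i (x, w)) = ‖w‖ ^ 2 := fun i x w hw => by
    rw [hval i _ (mem_range_self _), hround i x w hw]
  -- ### the thin tubes are round
  have hset : ∀ t : ℝ, 0 < t → t ≤ τ → {z | HS z < t} =
      ⋃ i, φ i '' (univ ×ˢ ball (0 : EuclideanSpace ℝ (Fin b)) (Real.sqrt t)) := by
    intro t ht htτ
    ext z
    simp only [mem_setOf_eq, mem_iUnion, mem_image, mem_prod, mem_univ, true_and, mem_ball,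
      dist_zero_right]
    constructor
    · intro hz
      obtain ⟨i, hzi⟩ := hlt z (hz.trans_le htτ)
      obtain ⟨⟨x, w⟩, rfl⟩ := hzi
      have hHlt : H i (φ i (x, w)) < τ := by
        rw [← hval i _ (mem_range_self _)]
        exact hz.trans_le htτ
      have hHeq : H i (φ i (x, w)) = ‖w‖ ^ 2 := by
        have h := (hHloc i _ hHlt).eq_of_nhds
        simp only [hF'φ] at h
        exact h
      have hw : ‖w‖ ^ 2 < t := by
        rw [← hHeq, ← hval i _ (mem_range_self _)]
        exact hz
      exact ⟨i, (x, w), (Real.lt_sqrt (norm_nonneg _)).2 hw, rfl⟩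
    · rintro ⟨i, ⟨x, w⟩, hw, rfl⟩
      have hw2 : ‖w‖ ^ 2 < t := (Real.lt_sqrt (norm_nonneg _)).1 hw
      show HS (φ i (x, w)) < t
      rw [hroundS i x w (hw2.trans_le htτ)]
      exact hw2
  -- ### the conclusions
  refine ⟨S', HS, τ, ρ, hτ, hρ, fun i x => hφzero i x, hφsub, hsmooth, fun z => ?_, fun z => ?_,
    fun z h0 h1 => ?_, fun i x w hw => hroundS i x w hw, hset, fun c z hz h1 h0 => ?_⟩
  · -- `0 ≤ H_S`
    by_cases h : ∃ i, z ∈ range (φ i)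
    · obtain ⟨i, hi⟩ := h
      rw [hval i z hi]
      exact hH0 i z
    · push Not at h
      rw [hval' z h]
      exact hτ.le
  · -- the zero set is the union of the core spheres of `S`
    constructor
    · intro hz
      obtain ⟨i, hi⟩ := hlt z (by rw [hz]; exact hτ)
      rw [hval i z hi] at hz
      obtain ⟨x, hx⟩ := (hHz i z).1 hz
      refine S.mem_cores_iff.2 ⟨i, x, ?_⟩
      rw [S.sphere_apply, ← hφzero i x]
      exact hx
    · intro hz
      obtain ⟨i, x, rfl⟩ := S.mem_cores_iff.1 hz
      rw [S.sphere_apply, ← hφzero i x, hval i _ (hsph i x)]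
      exact hHi0 i x
  · -- no critical points where `0 < H_S < τ`
    obtain ⟨i, hi⟩ := hlt z h1
    rw [hval i z hi] at h0 h1
    intro hc
    refine hHreg i z h0 h1 ?_
    unfold IsMCriticalPt at hc ⊢
    rwa [(hloc i z hi).mfderiv_eq] at hc
  · -- near a marked point of the cores: `H_S = ‖σ⁻¹ (Ψ_c,₂)‖²`
    obtain ⟨i, x, rfl⟩ := S.mem_cores_iff.1 hz
    have hzφ : S.sphere i x = φ i (x, 0) := by rw [S.sphere_apply, hφzero i x]
    rw [hzφ]
    rw [hzφ] at h1 h0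
    have h2 : H i =ᶠ[𝓝 (φ i (x, 0))] fun y => ‖F' i y‖ ^ 2 :=
      hHloc i _ (by rw [hHi0 i x]; exact hτ)
    have hall : ∀ᶠ y in 𝓝 (φ i (x, 0)), χ c y = 1 ∧ ∀ c', c' ≠ c → χ c' y = 0 := by
      refine h1.and (eventually_all.2 fun c' => ?_)
      by_cases hc' : c' = c
      · exact Eventually.of_forall fun y h => absurd hc' h
      · exact (h0 c' hc').mono fun y hy _ => hy
    have h3 : (fun y => ‖F' i y‖ ^ 2) =ᶠ[𝓝 (φ i (x, 0))] fun y => ‖σ.symm (Ψ c y).2‖ ^ 2 :=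
      hall.mono fun y hy => by
        show ‖σ.symm (F i y)‖ ^ 2 = ‖σ.symm (Ψ c y).2‖ ^ 2
        rw [hFc i c y hy.1 hy.2]
    exact ((hloc i _ (hsph i x)).trans h2).trans h3

end FramedSphereFamily

end Literature.Topology.FourManifolds

end
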